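import Summits.Ventures.AbcShadow.SH27.Che10Package
import Summits.Ventures.AbcShadow.SH27.NewformSound
import Summits.Ventures.AbcShadow.SH27.NewformData720
import Summits.Ventures.AbcShadow.SH27.CurveTable29

/-!
# Venture AbcShadow — ROW SH-27: `a² + b³⁴ = c⁵` has no non-trivial proper solution (Chen's excluded prime `p = 17`) — the
# typed, kernel-checked REDUCTION

HONEST FRAMING. A row of the work-bound cell `abc-shadow` (typer seat `abc-shadow-typ-4`): a CONDITIONAL, typed/kernel-checked
REDUCTION; no claim on abc or on any summit; no side on IUT. In print, [Che10, Thm 1/48] (I. Chen, Acta Arith. 143 (2010)) proves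
`SH27 p` for primes `p > 17`, `p ≡ 1 (mod 4)`; `p = 17` is EXCLUDED there because the printed (norm-wise, Weil-box) sieve at
level 180 leaves the bound set `{2, 3, 5, 7, 17}` [p.369 L27–28]. The cell closed `p = 17` by COMPUTATION (engine SH27,
certificate 1f9122f05be32705, PARI/GP 2.17.3, offline; INDEPENDENTLY RE-CHECKED, crit-1 g4 K3 PASS, memo 1a88b4065e90d063) with a
residue-class refinement of Chen's criterion. `sh27_p17_of` derives the target `SH27 17` (`SH27/Statement.lean`) from EXACTLY
these hypotheses on an arbitrary model `M : QNewformModel` (meaningful for the intended model only, `SH27/Che10Package.lean`):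

| hypothesis | what it says | nature |
|---|---|---|
| `hP : Che10Package M` | Lemma 2/3 + Thms 40–42 + Cor 44 + p.369 L1–3: a non-trivial proper solution gives coprime `(u,v)`, `E ∈ {E^s,E^t}` and a newform `g` of `S₂(Γ₀(M), ψ^{±1})`, `M ∈ {180,720}`, with `ρ̄_{E_β,β,π} ≅ ρ̄_{g,𝔓}` | CITED print [Che10] |
| `h48 : Che10CMEndgame M` | proof of Thm 48 + Cor 47 at `p = 17`: arising from a CM-by-`ℚ(i)` form is contradictory | CITED print [Che10] |
| `hL : LemmaSH27U M` | LEMMA-SH27-1 (Frobenius-power trace identities `p_f(a_q(g), ψ(q)q) ≡ a_𝔮(E_β(u,v)) (mod 𝔓)`, anchor [Che10 p.366]) + [Thm 36] level raising, at the actual residue class (U2) | UNPRINTED lemma (spec 9d55c9c4a06f0a3d U1/U2; analogue [BC12 L.24]) + CITED |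
| `hD : ∀ S, M.DataComplete S (orbitsOf S)` | the newforms of the four spaces are the transcribed orbits (`SH27/NewformData*.lean`) | COMPUTED (cert 1f9122f05be32705 (N); K3 re-derived) |
| `hCM : ∀ S, M.CMBy S (cmOrbitsOf S)` | the `3+3+3+3` orbits with `K_g = ℚ(i)` (`a₇ = a₁₁ = 0`, …) have CM by `ℚ(i)` | COMPUTED + CITED identification |

Everything else is PROVED here / in the imported files, in the kernel: Cayley–Hamilton for the power traces
(`SH27/PowerTrace.lean`); the twist rule and the realised trace sets `R₁₁ = {−14,6,18,22}`, `R₂₉ = {−42,22,42,54,58}` of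
`E^t_β, E^s_β` over `𝔽_{11²}`, `𝔽_{29²}` for ALL classes `(u,v) ≢ 0` (`SH27/CurveTwist.lean`, `SH27/CurveTables.lean`,
`SH27/CurveTable29.lean`); absence of singular classes mod `7, 11, 29` (so `q ∤ γ(u,v)`, good reduction, the level-raising
branch is void at these `q`); the primes `(11, z²+1)`, `(29, z²+3)`, `(7, z⁴−5z²+5)` of `K_β`; and the sieve itself
(`SH27/NewformData*.lean` + `orbitCheck_sound`): for each of the 12 non-CM orbits and EVERY characteristic-17 realisation
(= every prime `𝔓 ∣ 17`, `52 = 12+12+14+14` types), the power trace forced by `hL` is either no integer (`∉ 𝔽₁₇`) or an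
integer `≢` every realised curve trace mod 17 — the `4 + 4` degree-1 primes of the degree-6 orbit `180.ψ.5` die at
`q = 29` (required residue `6`, realised `{3,5,7,8,9}`), everything else at `q = 11` or `q = 7`; the CM orbits go to `h48`.
Words for this row (desk/director book; this file moves none): typed/kernel-checked REDUCTION; newform data COMPUTED
(certificate 1f9122f05be32705) entering as `DataComplete`/`CMBy`; print inputs NAMED; LEMMA-SH27-1/U2 NAMED (unprinted);
curve-side residue tables and the kill comparison IN KERNEL; adjacent (generalized Fermat `(2, 34, 5)`), NOT abc; no side
on IUT; abc is not proved by any of this. AI-typed; weaker than expert refereeing of the cited inputs.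
-/

namespace Summit.Ventures.AbcShadow
namespace SH27

/-- The transcribed orbit list of each space (`SH27/NewformData180.lean`, `SH27/NewformData720.lean`). [folklore] -/
def orbitsOf : Space → List Orbit27
  | .s180 => orbits_180a
  | .s180c => orbits_180b
  | .s720 => orbits_720a
  | .s720c => orbits_720b

/-- The CM (`K_g = ℚ(i)`) orbits of each space. [folklore] -/
def cmOrbitsOf : Space → List Orbit27
  | .s180 => cmOrbits_180a
  | .s180c => cmOrbits_180b
  | .s720 => cmOrbits_720a
  | .s720c => cmOrbits_720b

/-- **Kernel sieve, all four spaces**: every transcribed orbit is a CM orbit or has a passing `orbitCheck` certificate with kill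
primes `[29, 11, 7]` and the space's character. [folklore] -/
theorem sieve_of (S : Space) : ∀ o ∈ orbitsOf S, o ∈ cmOrbitsOf S ∨
    ∃ c : Cert27, c.primes = [29, 11, 7] ∧ orbitCheck o S.charExp fdeg realisedAt c = true := by
  cases S
  · exact sieve_180a
  · exact sieve_180b
  · exact sieve_720a
  · exact sieve_720b

/-- **The curve side at the three sieve primes.** For coprime `u, v`, either curve `E`, and any map `τ, ι` data: at each
`q ∈ {29, 11, 7}` the prime `𝔮_q ∈ {(29, z²+3), (11, z²+1), (7, z⁴−5z²+5)}` of `K_β` has `q ∤ γ(u,v)` (no singular class), and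
the trace `A = a_{𝔮_q}(E_β(u,v))` lies in `R₂₉`, `R₁₁` resp. is unconstrained — packaged as the `hid` hypothesis of
`orbitCheck_sound` from the identities supplied by `LemmaSH27U`. [folklore] -/
theorem hid_of_lemma {k : Type} [Field k] [CharP k 17] {u v : ℤ} (huv : IsCoprime u v) (E : CurveTag) (τ : ℕ → k) (ι : k)
    (e : ℕ → ℕ)
    (hφ : ∀ (q : ℕ) [NeZero q], q.Prime → q ≠ 2 → q ≠ 3 → q ≠ 5 → q ≠ 17 →
      (¬ (q : ℤ) ∣ gammaUV u v → ∀ h : List ℤ, IsKbetaPrime q h →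
        powerTrace (τ q) (ι ^ e q * q) (fdeg q) = (curveTrace E q h (u : ZMod q) (v : ZMod q) : k))) :
    ∀ q ∈ ([29, 11, 7] : List ℕ), ∃ A : ℤ, (∀ l, realisedAt q = some l → A ∈ l) ∧
      powerTrace (τ q) (ι ^ e q * q) (fdeg q) = (A : k) := by
  intro q hq
  simp only [List.mem_cons, List.not_mem_nil, or_false] at hq
  rcases hq with rfl | rfl | rfl
  · refine ⟨curveTrace E 29 [3, 0, 1] (u : ZMod 29) (v : ZMod 29), fun l hl => ?_, ?_⟩
    · have : l = R29 := by simpa [realisedAt] using hl.symm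
      subst this
      exact realised_29 E _ _ (zmod_ne_zero_of_isCoprime (by norm_num) huv)
    · exact hφ 29 (by norm_num) (by norm_num) (by norm_num) (by norm_num) (by norm_num)
        (not_dvd_gammaUV (by norm_num) noSingular_29 huv) [3, 0, 1] isKbetaPrime_used.2.1
  · refine ⟨curveTrace E 11 [1, 0, 1] (u : ZMod 11) (v : ZMod 11), fun l hl => ?_, ?_⟩
    · have : l = R11 := by simpa [realisedAt] using hl.symm
      subst this
      exact realised_11 E _ _ (zmod_ne_zero_of_isCoprime (by norm_num) huv)
    · exact hφ 11 (by norm_num) (by norm_num) (by norm_num) (by norm_num) (by norm_num)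
        (not_dvd_gammaUV (by norm_num) noSingular_11 huv) [1, 0, 1] isKbetaPrime_used.1
  · refine ⟨curveTrace E 7 [5, 0, -5, 0, 1] (u : ZMod 7) (v : ZMod 7), fun l hl => ?_, ?_⟩
    · simp [realisedAt] at hl
    · exact hφ 7 (by norm_num) (by norm_num) (by norm_num) (by norm_num) (by norm_num)
        (not_dvd_gammaUV (by norm_num) noSingular_7 huv) [5, 0, -5, 0, 1] isKbetaPrime_used.2.2

end SH27

open SH27 in
/-- **Row SH-27 (reduction theorem): `a² + b³⁴ = c⁵` has no non-trivial proper solution**, CONDITIONALLY on the named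
hypotheses (module docstring): the CITED [Che10] package (Lemma 2/3, Thms 40–42, Cor 44, p.369) and CM endgame (Thm 48/Cor 47
at `p = 17`), the UNPRINTED LEMMA-SH27-1 + U2 (with [Thm 36]), the COMPUTED newform data of the four spaces (`DataComplete`,
certificate 1f9122f05be32705) and their CM certification (`CMBy`). The case tree: `hP` gives `(u, v, E, S, g)`; `hL` a
characteristic-17 realisation `φ` with the trace identities; `hD` puts `g` on a transcribed orbit; a CM orbit is dispatched by
`hCM` + `h48`; a non-CM orbit by the KERNEL sieve (`sieve_of` + `orbitCheck_sound`) fed with the KERNEL curve tables at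
`q = 29, 11` (`hid_of_lemma`). ADJACENT (generalized Fermat `(2, 34, 5)`), NOT abc; Chen's printed word (`p > 17`) stays Chen's.
[cite: Chen2010, Thm 1 p.345 (p = 17 excluded in print; here conditionally on the named inputs)] -/
theorem sh27_p17_of (M : QNewformModel) (hP : Che10Package M) (h48 : Che10CMEndgame M) (hL : LemmaSH27U M)
    (hD : ∀ S : Space, M.DataComplete S (orbitsOf S)) (hCM : ∀ S : Space, M.CMBy S (cmOrbitsOf S)) : SH27 17 := by
  intro a b c heq hprop hab
  have heq' : a ^ 2 + b ^ 34 = c ^ 5 := by simpa using heq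
  obtain ⟨u, v, E, S, g, huv, -, har⟩ := hP a b c heq' hprop hab
  obtain ⟨k, _instF, _instC, φ, hφ⟩ := hL ⟨a, b, c, u, v, E⟩ S g har
  obtain ⟨hI2, o, ho, hmatch⟩ := hD S g
  rcases sieve_of S o ho with hcm | ⟨cert, hprimes, hcert⟩
  · exact h48 _ S g har (hCM S g o hcm hmatch)
  · obtain ⟨θ, hPθ, hent⟩ := hmatch
    refine orbitCheck_sound (k := k) hcert (ι := φ (M.rootI S g)) (θ := φ θ) ?_ ?_ (fun q => φ (M.eig S g q)) ?_ ?_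
    · rw [← map_pow, hI2, map_neg, map_one]
    · rw [← map_evalQi, hPθ, map_zero]
    · intro en hen
      have h := congrArg φ (hent en hen)
      rw [map_mul, map_intCast, map_evalQi] at h
      exact h
    · rw [hprimes]
      exact hid_of_lemma huv E (fun q => φ (M.eig S g q)) (φ (M.rootI S g)) S.charExp
        (fun q _ hq h2 h3 h5 h17 => (hφ q hq h2 h3 h5 h17).1)

open SH27 in
/-- **SH-27 trust base as one closed formula** (as `SH01/Hypotheses.lean` does for SH-01): for EVERY model of the interface, the
cited [Che10] package and CM endgame, LEMMA-SH27-1 + U2, the COMPUTED data of the four spaces and their CM certification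
together imply `SH27 17`; hypotheses displayed in the statement. ADJACENT, NOT abc. [cite: Chen2010, Thm 1 p.345 (p = 17 conditionally on the named inputs)] -/
theorem sh27_p17_trust_base :
    ∀ M : QNewformModel, Che10Package M → Che10CMEndgame M → LemmaSH27U M →
      (∀ S : Space, M.DataComplete S (orbitsOf S)) → (∀ S : Space, M.CMBy S (cmOrbitsOf S)) → SH27 17 :=
  fun M hP h48 hL hD hCM => sh27_p17_of M hP h48 hL hD hCM

end Summit.Ventures.AbcShadow
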